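import Literature.AnabelianGeometry.EtaleTheta.Discharge.Sec5Thm57KummerTorsionOfEtaleTower
import Literature.AnabelianGeometry.EtaleTheta.Discharge.Sec5DiscrepancyIntrinsic

/-!
# [EtTh] §5, Theorem 5.7 (C)-chain: the torsion clause of a family member `(a, b, w)` from the étale residual list when Thm. 5.6 at the
# member is given in the PRODUCED shape `(θ, e, D_c, D_p)` of the transport producers (pp. 324–331 / PDF pp. 98–105)

Mochizuki, *The étale theta function and its Frobenioid-theoretic manifestations*, Publ. RIMS **45** (2009)
[cite: MochizukiEtTh2009, Thm 5.7 proof p.329–330 (PDF pp.103–104); Thm 5.6 p.328 (PDF p.102); Thm 5.10 (ii) p.333–334 (PDF pp.107–108);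
Prop 5.2 (iii) p.324 (PDF p.98); Cor 2.19 (iii) p.291 (PDF p.65)]; *The geometry of Frobenioids I* [cite: MochizukiFrdI2008, Thm. 5.2 (i) p.100].
abc-iut cell, layer L2, node `EtTh:Thm5.7`; seat abc-iut-L2-d4 (gen 8), abc-iut-L2-lead R974/R990/R1038 «HK4FAM@SETTING-TOWER — CONSUMER KNIT»,
generic half.  PROOF-ONLY (0 definitions, 0 new named facts; nothing landed is edited or restated) over abc-iut-w6-d049's
`ThetaFrobenioidTower.kummerTorsion_of_etaleTower` (`Sec5Thm57KummerTorsionOfEtaleTower.lean`, p478416) and this lineage's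
`TemperedFrobenioid.discrepancy_eq_of_transports` (`Sec5DiscrepancyIntrinsic.lean`, p445839).

THE POINT.  The FINAL KNIT v6 of Thm. 5.7 with (C) from the étale side (`Sec5Thm57FinalKnitV6OfThetaSettingOfEtale.lean`, p480505, and its
twins p481337 / p486421) displays Thm. 5.6 at each family member `(a, b, w)` as `hK4fam`: «`∃ θb`, `θb(H_{B_N}) = H_{B_N}` ∧
`StrvTransport Ψ a (Iso.refl _) θb` ∧ shadow law ∧ (K4m)» — i.e. with the transport unit `e := 1`.  The tree's producers of these data at
the genuine base (abc-iut-w5-d245's `ThetaFrobenioid.exists_unit_transports_hYdd_ofConnectedTemperoidData_strv`, [FrdI] Prop. 5.6) deliver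
instead, for the GIVEN `(a, b)`, a unit `e ∈ O^×(A_N)` and `D_c, D_p ∈ Aut_C(B_N)` with
`a⁻¹ ≫ Ψ(s^⊓_N) ≫ b ≫ D_c⁻¹ = e ≫ s^⊓_N`, `a⁻¹ ≫ Ψ(s^⊔_N) ≫ b ≫ D_c⁻¹ = e ≫ s^⊔_N ≫ D_p`, `D_p ∈ O^×(B_N)`, `StrvTransport Ψ a e θ`,
`θ(H_{B_N}) = H_{B_N}` — the PRODUCED shape.  This file proves that the produced shape serves the (C)-chain equally well:
* `ThetaFrobenioid.mem_units_of_sCap_comp_inv_eq` — `s^⊓_N ≫ D_c⁻¹ = e ≫ s^⊓_N` with `e` a unit forces `D_c ∈ O^×(B_N)` (`s^⊓_N` is a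
  pre-step, so `Base(s^⊓_N)` is an isomorphism; `O^×(B_N) = Ker(Aut_C(B_N) → Aut_D(B_N^bs))`);
* `ThetaFrobenioid.psiAut_trans_symm_apply` / `…_eq_of_mem_units` — `Ψ^Aut` for `b ≫ D_c⁻¹` is `D_c⁻¹ · Ψ^Aut_b(−) · D_c`, hence agrees
  with `Ψ^Aut_b` on values in the abelian group `O^×(B_N)` ⊇ `μ_N(B_N)`: (K4m) may be stated at `b` (Thm. 5.10 (ii), p.333: "conjugation by `β`");
* `ThetaFrobenioid.eq_of_transports_of_model` — for §5 data whose operations are the model's ([EtTh] Def. 3.6 (ii) / [FrdI] Thm. 5.2 (i)),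
  the member's unit `w` (`a⁻¹ ≫ Ψ(s^⊓_N) ≫ b = s^⊓_N`, `a⁻¹ ≫ Ψ(s^⊔_N) ≫ b = s^⊔_N ≫ w`) IS the produced `D_p` (p445839: the discrepancy
  of a transported pair of base-equivalent pre-steps is intrinsic; `Φ` divisorial);
* `ThetaFrobenioidTower.kummerTorsion_of_etaleTower_of_trans_units` — p478416 with the transport read at `b ≫ D_c⁻¹` and (K4m) at `b`
  (generic tower; conclusion for `D_p`);
* `ThetaFrobenioidTower.kummerTorsion_of_etaleTower_ofProduced` — the member shape of `htorsfam` (conclusion for `w`) from the produced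
  data, for a tower at whose level `N` the unit discrepancy of a transported pair is intrinsic (`hδ` — a THEOREM wherever the operations
  are the model's: `eq_of_transports_of_model`; every level of the tower of the Setting is such, `rfl`).  (`hδ` is kept as a displayed
  clause of the GENERIC tower rather than derived from `𝔗.pre = ofModel …` so that consumers instantiate the large binder list over their
  own category term — the elaborator's unifier, not the mathematics, dictates this.)
HONEST FRAMING: kernel-checked compositions/identities; none of the displayed binders is proved here or asserted to hold at any model;
nothing of [EtTh] is asserted unconditionally; typed ≠ discharged; no side taken on anything downstream ([IUTchIII] Cor. 3.12 in particular).
-/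

namespace Literature.AnabelianGeometry.EtaleTheta

open CategoryTheory
open Literature.AlgebraicGeometry.Frobenioids

universe w v v' u u' u₀ v₀

/-! ### Generic §5 data: `D_c` is a unit; (K4m) is insensitive to `b ↦ b ≫ D_c⁻¹` -/

namespace ThetaFrobenioid

section Generic

variable {C : Type u} [Category.{v} C] {D : Type u'} [Category.{v'} D] {𝔉 : ThetaFrobenioid.{w} C D}

/-- **`D_c` is a unit.**  If `e ∈ O^×(A_N)` and `s^⊓_N ≫ D_c⁻¹ = e ≫ s^⊓_N`, then `D_c ∈ O^×(B_N)`: apply `Base`, use `Base(e) = id` and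
cancel the isomorphism `Base(s^⊓_N)` (`s^⊓_N` is a pre-step, p.330 (PDF p.104)); `O^×(B_N)` is the kernel of `Aut_C(B_N) → Aut_D(B_N^bs)`.
[cite: MochizukiEtTh2009, Thm 5.7 proof p.329–330 (PDF pp.103–104)] -/
theorem mem_units_of_sCap_comp_inv_eq {e : 𝔉.AN ≅ 𝔉.AN} (he : e ∈ 𝔉.units 𝔉.AN) {Dc : Aut 𝔉.BN}
    (h : 𝔉.sCap ≫ Dc.inv = e.hom ≫ 𝔉.sCap) : Dc ∈ 𝔉.units 𝔉.BN := by
  haveI : IsIso (𝔉.base.map 𝔉.sCap) := 𝔉.isPreStep_sCap.2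
  have h1 := congrArg (fun k => 𝔉.base.map k) h
  simp only [Functor.map_comp] at h1
  rw [𝔉.base_map_units _ e he, Category.id_comp] at h1
  have hb : 𝔉.base.map Dc.inv = 𝟙 _ :=
    (cancel_epi (𝔉.base.map 𝔉.sCap)).mp (h1.trans (Category.comp_id _).symm)
  have hinv : Dc⁻¹ ∈ 𝔉.units 𝔉.BN := ⟨hb, 𝔉.isLinear_of_aut _⟩
  exact inv_mem_iff.mp hinv

variable (Ψ : C ≌ C) (β : Ψ.functor.obj 𝔉.BN ≅ 𝔉.BN)

/-- **`Ψ^Aut` for the re-anchored `β ≫ D_c⁻¹`** is `D_c⁻¹ · Ψ^Aut_β(−) · D_c` ("applying `Ψ` followed by conjugation by `β`", Thm. 5.10 (ii),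
p.333 (PDF p.107)).  [cite: MochizukiEtTh2009, Thm 5.10 (ii) p.333 (PDF p.107)] -/
theorem psiAut_trans_symm_apply (Dc u : Aut 𝔉.BN) :
    𝔉.psiAut Ψ (β ≪≫ Dc.symm) u = Dc⁻¹ * 𝔉.psiAut Ψ β u * Dc := by
  apply Iso.ext
  rw [psiAut_hom]
  simp only [Iso.trans_inv, Iso.trans_hom, Iso.symm_inv, Iso.symm_hom, Aut.Aut_mul_def, Aut.Aut_inv_def, psiAut_hom,
    Category.assoc]

/-- **(K4m) is insensitive to `β ↦ β ≫ D_c⁻¹` for `D_c ∈ O^×(B_N)`** on arguments whose `Ψ^Aut_β`-value is a unit (e.g. lies in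
`μ_N(B_N)`): `O^×(B_N)` is abelian.  [cite: MochizukiEtTh2009, Thm 5.10 (ii) p.333–334 (PDF pp.107–108)] -/
theorem psiAut_trans_symm_eq_of_mem_units {Dc : Aut 𝔉.BN} (hDc : Dc ∈ 𝔉.units 𝔉.BN) {u : Aut 𝔉.BN}
    (hu : 𝔉.psiAut Ψ β u ∈ 𝔉.units 𝔉.BN) : 𝔉.psiAut Ψ (β ≪≫ Dc.symm) u = 𝔉.psiAut Ψ β u := by
  rw [psiAut_trans_symm_apply, mul_assoc, setLike_mul_comm (s := 𝔉.units 𝔉.BN) hu hDc, ← mul_assoc, inv_mul_cancel, one_mul]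

end Generic

/-! ### §5 data whose operations are the model's: the member's unit IS the produced `D_p` -/

section Model

variable {D₀ : Type u₀} [Category.{v₀} D₀] {V : FrdIMonoidStub.{w}} {T₀ : RealifiedDivisorMonoids (D₀ := D₀) V}
  {D : Type u} [Category.{v} D] {VD : FrdICatStub.{u, v, w} D} {C₀ : TemperedFrobenioid T₀ D VD}
  {𝔉 : ThetaFrobenioid.{w} C₀.category D}

/-- **The unit of a family member IS the produced discrepancy** (Thm. 5.7 proof, p.329–330 (PDF pp.103–104): `u := D_c⁻¹·D_p`; [FrdI]
Thm. 5.2 (i)).  For §5 data over a tempered Frobenioid whose operations `(Base, Div, deg_Fr)` are the model's ([EtTh] Def. 3.6 (ii)) with `Φ`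
divisorial: if `s^⊓_N ≫ D_c⁻¹ = e ≫ s^⊓_N` and `s^⊔_N ≫ w ≫ D_c⁻¹ = e ≫ s^⊔_N ≫ D_p` with `e ∈ O^×(A_N)`, `w, D_p ∈ O^×(B_N)`, then
`w = D_p` — this lineage's `TemperedFrobenioid.discrepancy_eq_of_transports` (p445839) read for the base-equivalent pre-steps
`(s^⊓_N, s^⊔_N)`.  [cite: MochizukiEtTh2009, Thm 5.7 proof p.329–330 (PDF pp.103–104)] -/
theorem eq_of_transports_of_model (h𝔉 : 𝔉.pre = PreFrobenioidData.ofModel C₀.divisorMonoid C₀.ratFnFunctor C₀.divBNatTrans)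
    (hΦd : Objectwise (fun M _ => IsDivisorial M) C₀.divisorMonoid)
    {e : 𝔉.AN ≅ 𝔉.AN} (he : e ∈ 𝔉.units 𝔉.AN) {w Dc Dp : Aut 𝔉.BN} (hw : w ∈ 𝔉.units 𝔉.BN) (hDp : Dp ∈ 𝔉.units 𝔉.BN)
    (h' : 𝔉.sCap ≫ Dc.inv = e.hom ≫ 𝔉.sCap) (h'' : 𝔉.sCup ≫ w.hom ≫ Dc.inv = e.hom ≫ 𝔉.sCup ≫ Dp.hom) : w = Dp := by
  have hDc : Dc ∈ 𝔉.units 𝔉.BN := mem_units_of_sCap_comp_inv_eq he h'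
  -- the dictionary `𝔉.pre = ofModel`: units, linearity and base maps are the model's (all definitional after `h𝔉`)
  have hu : ∀ {S : C₀.category} {x : Aut S}, x ∈ 𝔉.units S → x ∈ ModelFrobenioid.units S := by
    intro S x hx
    have hx' : x ∈ (PreFrobenioidData.ofModel C₀.divisorMonoid C₀.ratFnFunctor C₀.divBNatTrans).unitsSubgroup S := by
      rw [← h𝔉]; exact hx
    exact hx'
  have hcap : ModelFrobenioid.degFr 𝔉.sCap = 1 ∧ IsIso (ModelFrobenioid.baseMap 𝔉.sCap) := by
    have h1 := 𝔉.isPreStep_sCap; rw [h𝔉] at h1; exact h1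
  have hcup : ModelFrobenioid.degFr 𝔉.sCup = 1 ∧ IsIso (ModelFrobenioid.baseMap 𝔉.sCup) := by
    have h1 := 𝔉.isPreStep_sCup; rw [h𝔉] at h1; exact h1
  have hb : ModelFrobenioid.baseMap 𝔉.sCap = ModelFrobenioid.baseMap 𝔉.sCup := by
    have h1 := 𝔉.base_map_sCap; rw [h𝔉] at h1; exact h1
  haveI : IsIso (ModelFrobenioid.baseMap 𝔉.sCup) := hcup.2
  exact C₀.discrepancy_eq_of_transports hΦd hcap.1 hcup.1 hb (hu he) (hu hw) (hu hDc) (hu hDp) h' h''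

end Model

end ThetaFrobenioid

/-! ### The torsion clause of a member from the PRODUCED Thm. 5.6 data -/

namespace ThetaFrobenioidTower

section Generic

variable {C : Type u} [Category.{v} C] {D : Type u'} [Category.{v'} D] (𝔗 : ThetaFrobenioidTower.{w} C D)
  (Ψ : C ≌ C) {E : Set ℕ+} (𝒯 : ThetaEnvTower.{v} E)

/-- **The torsion clause for the produced unit `D_p`** — abc-iut-w6-d049's `kummerTorsion_of_etaleTower` (p478416) with the normalised
transport datum read at the re-anchored `b ≫ D_c⁻¹` (`D_c ∈ O^×(B_N)`) while (K4m) is stated at `b` (legitimate by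
`psiAut_trans_symm_eq_of_mem_units`: the (K4m) values lie in `μ_N(B_N) ⊆ O^×(B_N)`).  Every other binder VERBATIM p478416.
[cite: MochizukiEtTh2009, Thm 5.7 proof p.330 (PDF p.104); Thm 5.6 p.328 (PDF p.102); Cor 2.19 (iii) p.291 (PDF p.65)] -/
theorem kummerTorsion_of_etaleTower_of_trans_units
    -- the §5 ↔ §2 dictionary at every level `M ∈ E`
    (ι : 𝔗.PiX ≃* 𝒯.PiX) (hι : ∀ y : 𝔗.PiX, y ∈ 𝔗.PiYdd ↔ ι y ∈ 𝒯.PiYdd)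
    (m : ∀ M : E, (𝔗.atLevel M).muTorsion (𝔗.atLevel M).BN (𝔗.atLevel M).N ≃* (𝒯.level M).mu)
    (hχ : ∀ M : E, (𝔗.atLevel M).CyclotomicCharacterCompat (𝒯.level M) ι (m M))
    (H : ∀ M : E, (𝔗.atLevel M).Facts)
    (η : ∀ M : E, 𝒯.PiYdd → 𝒯.mu M) (hη : ∀ M, η M ∈ 𝒯.thetaCocycles M)
    (hηc : ∀ (M M' : E) (h : (M : ℕ+) ∣ M'), 𝒯.red M M' h ∘ η M' = η M)
    (hpin : ∀ M : E, (𝔗.atLevel M).ThetaSectionCompat (H M) (𝒯.level M) ι (m M) hι (η M))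
    -- étale side on the tower
    (γ : 𝒯.PiX ≃ₜ* 𝒯.PiX) (hγ : 𝒯.PiYdd.map γ.toMulEquiv.toMonoidHom = 𝒯.PiYdd)
    (hγ' : ∀ x : 𝒯.PiX, x ∈ 𝒯.PiYdd → γ x ∈ 𝒯.PiYdd) (γμ : ∀ M : E, 𝒯.mu M ≃* 𝒯.mu M)
    (hstd : ∃ cf : ∀ M : E, 𝒯.G → 𝒯.mu M,
      (∀ M, CycEnvelope.IsEnvCocycle (MonoidHom.id 𝒯.G) (𝒯.chi M) (cf M)) ∧
      (∀ M, IsLocallyConstant (cf M ∘ 𝒯.aug)) ∧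
      (∀ (M M' : E) (h : (M : ℕ+) ∣ M'), 𝒯.red M M' h ∘ cf M' = cf M) ∧
      (∀ M, 𝒯.pullbackCocycle M γ hγ (γμ M) '' 𝒯.thetaCocycles M =
        (fun η => η * (cf M ∘ 𝒯.aug ∘ 𝒯.PiYdd.subtype)) '' 𝒯.thetaCocycles M) ∧
      ∀ M : E, ∃ d : 𝒯.mu M, ∀ g : 𝒯.G, cf M g ^ 𝔗.l = CycEnvelope.coboundary (MonoidHom.id 𝒯.G) (𝒯.chi M) d g)
    (hγμχ : ∀ (M : E) (x : 𝒯.PiX) (t : 𝒯.mu M), γμ M (𝒯.chi M (𝒯.aug x) t) = 𝒯.chi M (𝒯.aug (γ x)) (γμ M t))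
    (hγμred : ∀ (M M' : E) (h : (M : ℕ+) ∣ M') (t : 𝒯.mu M'), 𝒯.red M M' h (γμ M' t) = γμ M (𝒯.red M M' h t))
    (haug : ∀ x y : 𝒯.PiX, 𝒯.aug x = 𝒯.aug y → 𝒯.aug (γ x) = 𝒯.aug (γ y))
    -- translation-freeness in étale currency: `γ^*η_M / η_M` is inflated at every level
    (hinfη : ∀ (M : E) (k k' : 𝒯.PiYdd), 𝒯.aug k = 𝒯.aug k' →
      (η M k)⁻¹ * γμ M (η M ⟨γ.symm k, 𝒯.symm_apply_mem_PiYdd_of_map_eq γ hγ k k.2⟩) =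
        (η M k')⁻¹ * γμ M (η M ⟨γ.symm k', 𝒯.symm_apply_mem_PiYdd_of_map_eq γ hγ k' k'.2⟩))
    -- separation across levels
    (hsep : ∀ η' : ∀ M : E, 𝒯.PiYdd → 𝒯.mu M, (∀ M, η' M ∈ 𝒯.thetaCocycles M) →
      (∀ (M M' : E) (h : (M : ℕ+) ∣ M'), 𝒯.red M M' h ∘ η' M' = η' M) →
      (∀ (M : E) (k k' : 𝒯.PiYdd), 𝒯.aug k = 𝒯.aug k' → η' M k * (η M k)⁻¹ = η' M k' * (η M k')⁻¹) →
      ∀ M : E, ∃ d : 𝒯.mu M, ∀ k : 𝒯.PiYdd,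
        (η' M k * (η M k)⁻¹) ^ 2 = CycEnvelope.coboundary (𝒯.aug.comp 𝒯.PiYdd.subtype) (𝒯.chi M) d k)
    -- ONE transport datum at a level `N ∈ E` in the PRODUCED shape: `(a, b)`, the unit `e`, `D_c ∈ O^×(B_N)`, `D_p`, a base shadow `θ`
    {N : ℕ+} (hN : N ∈ E)
    (a : Ψ.functor.obj (𝔗.AN N) ≅ 𝔗.AN N) (b : Ψ.functor.obj (𝔗.BN N) ≅ 𝔗.BN N) (e : 𝔗.AN N ≅ 𝔗.AN N) (Dc Dp : Aut (𝔗.BN N))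
    (hDc : Dc ∈ (𝔗.atLevel N).units (𝔗.BN N))
    (θ : Aut (𝔗.pre.base.obj (𝔗.BN N)) ≃* Aut (𝔗.pre.base.obj (𝔗.BN N)))
    (hYdd : (𝔗.atLevel N).HB.map θ.toMonoidHom = (𝔗.atLevel N).HB)
    (hT : a.inv ≫ Ψ.functor.map (𝔗.sCap N) ≫ (b ≪≫ Dc.symm).hom = e.hom ≫ 𝔗.sCap N ≫ (1 : Aut (𝔗.BN N)).hom)
    (hT' : a.inv ≫ Ψ.functor.map (𝔗.sCup N) ≫ (b ≪≫ Dc.symm).hom = e.hom ≫ 𝔗.sCup N ≫ Dp.hom)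
    (hstrv : (𝔗.atLevel N).StrvTransport Ψ a e θ) (hDp : Dp ∈ (𝔗.atLevel N).units (𝔗.BN N))
    (hshadow : ∀ k : 𝔗.PiYdd, θ (𝔗.ρ N k) = 𝔗.ρ N (ι.symm (γ (ι k))))
    -- (K4m) AT `b`
    (hK4 : ∀ x : 𝒯.mu ⟨N, hN⟩, (𝔗.atLevel N).psiAut Ψ b
        (((m ⟨N, hN⟩).symm x : (𝔗.atLevel N).muTorsion (𝔗.atLevel N).BN (𝔗.atLevel N).N) : Aut (𝔗.atLevel N).BN) =
      (((m ⟨N, hN⟩).symm (γμ ⟨N, hN⟩ x) : (𝔗.atLevel N).muTorsion (𝔗.atLevel N).BN (𝔗.atLevel N).N) :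
        Aut (𝔗.atLevel N).BN)) :
    ∃ u ∈ (𝔗.atLevel N).muTorsion (𝔗.BN N) N, ∀ k : (𝔗.atLevel N).PiYdd,
      𝔗.sgpCup N ((𝔗.atLevel N).rhoYdd k) * Dp ^ (2 * 𝔗.l) * (𝔗.sgpCup N ((𝔗.atLevel N).rhoYdd k))⁻¹ * (Dp ^ (2 * 𝔗.l))⁻¹ =
        𝔗.sgpCup N ((𝔗.atLevel N).rhoYdd k) * u * (𝔗.sgpCup N ((𝔗.atLevel N).rhoYdd k))⁻¹ * u⁻¹ := by
  -- (K4m) at `b ≫ D_c⁻¹`: the values `m_N⁻¹(γ_μ x)` lie in `μ_N(B_N) ⊆ O^×(B_N)`, which is abelian and contains `D_c`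
  have hK4' : ∀ x : 𝒯.mu ⟨N, hN⟩, (𝔗.atLevel N).psiAut Ψ (b ≪≫ Dc.symm)
        (((m ⟨N, hN⟩).symm x : (𝔗.atLevel N).muTorsion (𝔗.atLevel N).BN (𝔗.atLevel N).N) : Aut (𝔗.atLevel N).BN) =
      (((m ⟨N, hN⟩).symm (γμ ⟨N, hN⟩ x) : (𝔗.atLevel N).muTorsion (𝔗.atLevel N).BN (𝔗.atLevel N).N) :
        Aut (𝔗.atLevel N).BN) := by
    intro x
    have hu : (𝔗.atLevel N).psiAut Ψ b
        (((m ⟨N, hN⟩).symm x : (𝔗.atLevel N).muTorsion (𝔗.atLevel N).BN (𝔗.atLevel N).N) : Aut (𝔗.atLevel N).BN) ∈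
          (𝔗.atLevel N).units (𝔗.BN N) := by
      rw [hK4 x]
      exact (𝔗.atLevel N).muTorsion_le_units _ _ ((m ⟨N, hN⟩).symm (γμ ⟨N, hN⟩ x)).2
    exact (ThetaFrobenioid.psiAut_trans_symm_eq_of_mem_units (𝔉 := 𝔗.atLevel N) Ψ b hDc hu).trans (hK4 x)
  exact 𝔗.kummerTorsion_of_etaleTower Ψ 𝒯 ι hι m hχ H η hη hηc hpin γ hγ hγ' γμ hstd hγμχ hγμred haug hinfη hsep hN a
    (b ≪≫ Dc.symm) e Dp θ hYdd hT hT' hstrv hDp hshadow hK4'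

end Generic

section Produced

variable {C : Type u} [Category.{v} C] {D : Type u'} [Category.{v'} D] (𝔗 : ThetaFrobenioidTower.{w} C D)
  (Ψ : C ≌ C) {E : Set ℕ+} (𝒯 : ThetaEnvTower.{v} E)

/-- **The member shape of `htorsfam` from the PRODUCED Thm. 5.6 data.**  For a family member `(a, b, w)` — `w ∈ O^×(B_N)`,
`a⁻¹ ≫ Ψ(s^⊓_N) ≫ b = s^⊓_N`, `a⁻¹ ≫ Ψ(s^⊔_N) ≫ b = s^⊔_N ≫ w` — and produced data `(θ, e, D_c, D_p)` at the member (`e ∈ O^×(A_N)`, the two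
transport equations at `b ≫ D_c⁻¹`, `D_p ∈ O^×(B_N)`, `StrvTransport Ψ a e θ`, `θ(H_{B_N}) = H_{B_N}`), the shadow law for `θ` and (K4m) at `b`,
over a tower at whose level `N` the unit discrepancy of a transported pair is intrinsic (`hδ`, [FrdI] Thm. 5.2 (i): a THEOREM for the model's
operations, `ThetaFrobenioid.eq_of_transports_of_model`), the Kummer cocycle of `w^{2l}` along `H_{B_N}` is that of a torsion unit:
`∃ u ∈ μ_N(B_N), ∀ k ∈ Π^tp_Ÿ̲, s^⊔-gp_N(ρk)·w^{2l}·s^⊔-gp_N(ρk)⁻¹·w^{−2l} = s^⊔-gp_N(ρk)·u·s^⊔-gp_N(ρk)⁻¹·u⁻¹` — VERBATIM the member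
shape of `htorsfam` of '_final_v6'.  Route: `D_c ∈ O^×(B_N)` (`mem_units_of_sCap_comp_inv_eq`), `w = D_p` (`hδ`), then
`kummerTorsion_of_etaleTower_of_trans_units`.
[cite: MochizukiEtTh2009, Thm 5.7 proof p.329–330 (PDF pp.103–104); Thm 5.6 p.328 (PDF p.102); Cor 2.19 (iii) p.291 (PDF p.65)] -/
theorem kummerTorsion_of_etaleTower_ofProduced
    -- the §5 ↔ §2 dictionary at every level `M ∈ E`
    (ι : 𝔗.PiX ≃* 𝒯.PiX) (hι : ∀ y : 𝔗.PiX, y ∈ 𝔗.PiYdd ↔ ι y ∈ 𝒯.PiYdd)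
    (m : ∀ M : E, (𝔗.atLevel M).muTorsion (𝔗.atLevel M).BN (𝔗.atLevel M).N ≃* (𝒯.level M).mu)
    (hχ : ∀ M : E, (𝔗.atLevel M).CyclotomicCharacterCompat (𝒯.level M) ι (m M))
    (H : ∀ M : E, (𝔗.atLevel M).Facts)
    (η : ∀ M : E, 𝒯.PiYdd → 𝒯.mu M) (hη : ∀ M, η M ∈ 𝒯.thetaCocycles M)
    (hηc : ∀ (M M' : E) (h : (M : ℕ+) ∣ M'), 𝒯.red M M' h ∘ η M' = η M)
    (hpin : ∀ M : E, (𝔗.atLevel M).ThetaSectionCompat (H M) (𝒯.level M) ι (m M) hι (η M))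
    -- étale side on the tower
    (γ : 𝒯.PiX ≃ₜ* 𝒯.PiX) (hγ : 𝒯.PiYdd.map γ.toMulEquiv.toMonoidHom = 𝒯.PiYdd)
    (hγ' : ∀ x : 𝒯.PiX, x ∈ 𝒯.PiYdd → γ x ∈ 𝒯.PiYdd) (γμ : ∀ M : E, 𝒯.mu M ≃* 𝒯.mu M)
    (hstd : ∃ cf : ∀ M : E, 𝒯.G → 𝒯.mu M,
      (∀ M, CycEnvelope.IsEnvCocycle (MonoidHom.id 𝒯.G) (𝒯.chi M) (cf M)) ∧
      (∀ M, IsLocallyConstant (cf M ∘ 𝒯.aug)) ∧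
      (∀ (M M' : E) (h : (M : ℕ+) ∣ M'), 𝒯.red M M' h ∘ cf M' = cf M) ∧
      (∀ M, 𝒯.pullbackCocycle M γ hγ (γμ M) '' 𝒯.thetaCocycles M =
        (fun η => η * (cf M ∘ 𝒯.aug ∘ 𝒯.PiYdd.subtype)) '' 𝒯.thetaCocycles M) ∧
      ∀ M : E, ∃ d : 𝒯.mu M, ∀ g : 𝒯.G, cf M g ^ 𝔗.l = CycEnvelope.coboundary (MonoidHom.id 𝒯.G) (𝒯.chi M) d g)
    (hγμχ : ∀ (M : E) (x : 𝒯.PiX) (t : 𝒯.mu M), γμ M (𝒯.chi M (𝒯.aug x) t) = 𝒯.chi M (𝒯.aug (γ x)) (γμ M t))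
    (hγμred : ∀ (M M' : E) (h : (M : ℕ+) ∣ M') (t : 𝒯.mu M'), 𝒯.red M M' h (γμ M' t) = γμ M (𝒯.red M M' h t))
    (haug : ∀ x y : 𝒯.PiX, 𝒯.aug x = 𝒯.aug y → 𝒯.aug (γ x) = 𝒯.aug (γ y))
    (hinfη : ∀ (M : E) (k k' : 𝒯.PiYdd), 𝒯.aug k = 𝒯.aug k' →
      (η M k)⁻¹ * γμ M (η M ⟨γ.symm k, 𝒯.symm_apply_mem_PiYdd_of_map_eq γ hγ k k.2⟩) =
        (η M k')⁻¹ * γμ M (η M ⟨γ.symm k', 𝒯.symm_apply_mem_PiYdd_of_map_eq γ hγ k' k'.2⟩))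
    (hsep : ∀ η' : ∀ M : E, 𝒯.PiYdd → 𝒯.mu M, (∀ M, η' M ∈ 𝒯.thetaCocycles M) →
      (∀ (M M' : E) (h : (M : ℕ+) ∣ M'), 𝒯.red M M' h ∘ η' M' = η' M) →
      (∀ (M : E) (k k' : 𝒯.PiYdd), 𝒯.aug k = 𝒯.aug k' → η' M k * (η M k)⁻¹ = η' M k' * (η M k')⁻¹) →
      ∀ M : E, ∃ d : 𝒯.mu M, ∀ k : 𝒯.PiYdd,
        (η' M k * (η M k)⁻¹) ^ 2 = CycEnvelope.coboundary (𝒯.aug.comp 𝒯.PiYdd.subtype) (𝒯.chi M) d k)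
    -- the family MEMBER `(a, b, w)` at a level `N ∈ E` (the `htorsfam` / `hK4fam` member shape of '_final_v6')
    {N : ℕ+} (hN : N ∈ E)
    (a : Ψ.functor.obj (𝔗.AN N) ≅ 𝔗.AN N) (b : Ψ.functor.obj (𝔗.BN N) ≅ 𝔗.BN N) (w : Aut (𝔗.BN N))
    (hw : w ∈ (𝔗.atLevel N).units (𝔗.BN N))
    (hTa : a.inv ≫ Ψ.functor.map (𝔗.sCap N) ≫ b.hom = 𝔗.sCap N)
    (hTb : a.inv ≫ Ψ.functor.map (𝔗.sCup N) ≫ b.hom = 𝔗.sCup N ≫ w.hom)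
    -- the PRODUCED Thm. 5.6 data at the member: `(θ, e, D_c, D_p)`
    (θ : Aut (𝔗.pre.base.obj (𝔗.BN N)) ≃* Aut (𝔗.pre.base.obj (𝔗.BN N))) (e : 𝔗.AN N ≅ 𝔗.AN N)
    (he : e ∈ (𝔗.atLevel N).units (𝔗.AN N)) (Dc Dp : Aut (𝔗.BN N))
    (hT : a.inv ≫ Ψ.functor.map (𝔗.sCap N) ≫ (b ≪≫ Dc.symm).hom = e.hom ≫ 𝔗.sCap N ≫ (1 : Aut (𝔗.BN N)).hom)
    (hT' : a.inv ≫ Ψ.functor.map (𝔗.sCup N) ≫ (b ≪≫ Dc.symm).hom = e.hom ≫ 𝔗.sCup N ≫ Dp.hom)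
    (hDp : Dp ∈ (𝔗.atLevel N).units (𝔗.BN N)) (hstrv : (𝔗.atLevel N).StrvTransport Ψ a e θ)
    (hYdd : (𝔗.atLevel N).HB.map θ.toMonoidHom = (𝔗.atLevel N).HB)
    (hshadow : ∀ k : 𝔗.PiYdd, θ (𝔗.ρ N k) = 𝔗.ρ N (ι.symm (γ (ι k))))
    (hK4 : ∀ x : 𝒯.mu ⟨N, hN⟩, (𝔗.atLevel N).psiAut Ψ b
        (((m ⟨N, hN⟩).symm x : (𝔗.atLevel N).muTorsion (𝔗.atLevel N).BN (𝔗.atLevel N).N) : Aut (𝔗.atLevel N).BN) =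
      (((m ⟨N, hN⟩).symm (γμ ⟨N, hN⟩ x) : (𝔗.atLevel N).muTorsion (𝔗.atLevel N).BN (𝔗.atLevel N).N) :
        Aut (𝔗.atLevel N).BN))
    -- the unit discrepancy of a transported pair at level `N` is INTRINSIC ([FrdI] Thm. 5.2 (i); `eq_of_transports_of_model`)
    (hδ : ∀ {e' : 𝔗.AN N ≅ 𝔗.AN N} {w' Dc' Dp' : Aut (𝔗.BN N)}, e' ∈ (𝔗.atLevel N).units (𝔗.AN N) →
      w' ∈ (𝔗.atLevel N).units (𝔗.BN N) → Dp' ∈ (𝔗.atLevel N).units (𝔗.BN N) → 𝔗.sCap N ≫ Dc'.inv = e'.hom ≫ 𝔗.sCap N →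
      𝔗.sCup N ≫ w'.hom ≫ Dc'.inv = e'.hom ≫ 𝔗.sCup N ≫ Dp'.hom → w' = Dp') :
    ∃ u ∈ (𝔗.atLevel N).muTorsion (𝔗.BN N) N, ∀ k : (𝔗.atLevel N).PiYdd,
      𝔗.sgpCup N ((𝔗.atLevel N).rhoYdd k) * w ^ (2 * 𝔗.l) * (𝔗.sgpCup N ((𝔗.atLevel N).rhoYdd k))⁻¹ * (w ^ (2 * 𝔗.l))⁻¹ =
        𝔗.sgpCup N ((𝔗.atLevel N).rhoYdd k) * u * (𝔗.sgpCup N ((𝔗.atLevel N).rhoYdd k))⁻¹ * u⁻¹ := by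
  -- the member's equations vs the produced ones: `s^⊓_N ≫ D_c⁻¹ = e ≫ s^⊓_N`, `s^⊔_N ≫ w ≫ D_c⁻¹ = e ≫ s^⊔_N ≫ D_p`
  have h₁ : 𝔗.sCap N ≫ Dc.inv = e.hom ≫ 𝔗.sCap N :=
    calc 𝔗.sCap N ≫ Dc.inv = (a.inv ≫ Ψ.functor.map (𝔗.sCap N) ≫ b.hom) ≫ Dc.inv := by rw [hTa]
      _ = a.inv ≫ Ψ.functor.map (𝔗.sCap N) ≫ (b ≪≫ Dc.symm).hom := by
          simp only [Iso.trans_hom, Iso.symm_hom, Category.assoc]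
      _ = e.hom ≫ 𝔗.sCap N ≫ (1 : Aut (𝔗.BN N)).hom := hT
      _ = e.hom ≫ 𝔗.sCap N := by
          show e.hom ≫ 𝔗.sCap N ≫ (Iso.refl _).hom = _
          rw [Iso.refl_hom, Category.comp_id]
  have h₂ : 𝔗.sCup N ≫ w.hom ≫ Dc.inv = e.hom ≫ 𝔗.sCup N ≫ Dp.hom :=
    calc 𝔗.sCup N ≫ w.hom ≫ Dc.inv = (a.inv ≫ Ψ.functor.map (𝔗.sCup N) ≫ b.hom) ≫ Dc.inv := by
          rw [hTb]; simp only [Category.assoc]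
      _ = a.inv ≫ Ψ.functor.map (𝔗.sCup N) ≫ (b ≪≫ Dc.symm).hom := by
          simp only [Iso.trans_hom, Iso.symm_hom, Category.assoc]
      _ = e.hom ≫ 𝔗.sCup N ≫ Dp.hom := hT'
  have hDc : Dc ∈ (𝔗.atLevel N).units (𝔗.BN N) :=
    ThetaFrobenioid.mem_units_of_sCap_comp_inv_eq (𝔉 := 𝔗.atLevel N) he h₁
  -- `w = D_p` ([FrdI] Thm. 5.2 (i))
  have hwDp : w = Dp := hδ he hw hDp h₁ h₂
  rw [hwDp]
  exact 𝔗.kummerTorsion_of_etaleTower_of_trans_units Ψ 𝒯 ι hι m hχ H η hη hηc hpin γ hγ hγ' γμ hstd hγμχ hγμred haug hinfη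
    hsep hN a b e Dc Dp hDc θ hYdd hT hT' hstrv hDp hshadow hK4

end Produced

section Model

variable {D₀ : Type u₀} [Category.{v₀} D₀] {V : FrdIMonoidStub.{w}} {T₀ : RealifiedDivisorMonoids (D₀ := D₀) V}
  {D : Type u} [Category.{v} D] {VD : FrdICatStub.{u, v, w} D} {C₀ : TemperedFrobenioid T₀ D VD}
  (𝔗 : ThetaFrobenioidTower.{w} C₀.category D)

/-- **The clause `hδ` of `kummerTorsion_of_etaleTower_ofProduced` is a THEOREM for a tower whose operations are the model's** ([EtTh]
Def. 3.6 (ii) / [FrdI] Thm. 5.2 (i); every tower `ofBiKummerFamily` / `ofConnectedTemperoidFamily` / `ofThetaSettingFamily`, by `rfl`):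
`ThetaFrobenioid.eq_of_transports_of_model` at the level `N` (stated on the tower's own fields, so that a consumer's elaboration never unfolds
`atLevel`).  [cite: MochizukiEtTh2009, Thm 5.7 proof p.329–330 (PDF pp.103–104)] -/
theorem eq_of_transports_of_model (h𝔗 : 𝔗.pre = PreFrobenioidData.ofModel C₀.divisorMonoid C₀.ratFnFunctor C₀.divBNatTrans)
    (hΦd : Objectwise (fun M _ => IsDivisorial M) C₀.divisorMonoid) {N : ℕ+} {e : 𝔗.AN N ≅ 𝔗.AN N} {w Dc Dp : Aut (𝔗.BN N)}
    (he : e ∈ (𝔗.atLevel N).units (𝔗.AN N)) (hw : w ∈ (𝔗.atLevel N).units (𝔗.BN N)) (hDp : Dp ∈ (𝔗.atLevel N).units (𝔗.BN N))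
    (h' : 𝔗.sCap N ≫ Dc.inv = e.hom ≫ 𝔗.sCap N) (h'' : 𝔗.sCup N ≫ w.hom ≫ Dc.inv = e.hom ≫ 𝔗.sCup N ≫ Dp.hom) : w = Dp :=
  ThetaFrobenioid.eq_of_transports_of_model (𝔉 := 𝔗.atLevel N) h𝔗 hΦd he hw hDp h' h''

end Model

end ThetaFrobenioidTower

end Literature.AnabelianGeometry.EtaleTheta
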